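import Summits.KontsevichZagierPeriods.KontsevichZagierPeriods.Theorems.RootDecompRelativeModAbsoluteRegFoldingDegOneP03

/-!
# `RegFoldingDegOne` (route `RootDecompRelativeModAbsolute`, support item stmt-KontsevichZagierPeriods-30571) — PROVED · part 4/14

Cell `decomp-kz`, lens 3 (decomp-kz-lens-3 g9): `regFoldingDegOne_holds :
Theses.RootDecompRelativeModAbsolute.RegFoldingDegOne` BY NAME (in part 14/14) — every Kontsevich–Zagier
integral representation on `ℝ²` whose integrand is a quotient `p/q` of `ℚ`-polynomials with `deg_t q ≤ 1`,
`q ≠ 0` on the domain, is equivalent in `KZ.relations` to `[g] + Σᵢ [Uᵢ]`, the `Uᵢ` honest 2-cells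
`[g.domain × (0,1), hᵢ(x) θ^{Mᵢ}/(1 + θ^{eᵢ} κᵢ(x))]` (unfolded REGULARISED log/arctan monomials), with the
fibre integrals matching a.e.  Architecture: §1–§2 regularised terms `RTerm`, `RegFolding d`; §7 a.e.-congruence;
§8 gluing (`FoldsTo`); §9 one-band toolkit; §P analytic core (kernel independence); §10 cylinders; §11 affine band
chart; §13 `RegFolding 1` from a CAD band cover a.e. + vanishing on unbounded bands; last part: the edge to the born
item text and `regFoldingDegOne_holds`.

Source: `HOME/decomp-kz-lens-3/g9/landing/RootDecompRelativeModAbsoluteRegFoldingDegOne.lean` sha256 60038aa44a5f6303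
(4275 l; critic decomp-kz-crit-1 g2 CLEARED/kernel-confirmed 2026-08-30T09:41:19Z, std axioms), split mechanically
into 14 modules ≤ 400 lines by the landing seat decomp-kz-census-1 g7 (contexts re-opened per part; generic docstrings
added where the source had none; parts 1–13 do not import the route file).  No `sorry`; standard axioms.
References: [cite: KontsevichZagier2001, §1.2]; Basu–Pollack–Roy 2006 Def. 5.1 / Cor. 5.7; Bochnak–Coste–Roy 1998 §2.9.
-/

noncomputable section

open Set MeasureTheory Filter Topology
open scoped BigOperators
open Literature.NumberTheory.Transcendental Literature.ModelTheory.ExponentialFields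

namespace Summit.KontsevichZagierPeriods.RootDecompRelativeModAbsolute.Rung30571

namespace RegularisedLogLayer

section Folds

variable {b : ℕ}

/-- **Gluing over a finite cover** (the form the prover uses after the cylindrical decomposition):
finitely many `ℚ`-semialgebraic pieces `D j ⊆ r.domain` with pairwise-null overlaps covering
`r.domain` up to a null set, each restriction folding to some admissible term ⇒ `r` folds. -/
theorem foldsTo_of_cover {r : KZ.IntegralRep (b + 1)} {N : ℕ} (D : Fin N → Set (Fin (b + 1) → ℝ))
    (hD : ∀ j, IsSemialgebraic ℚ (D j)) (hDr : ∀ j, D j ⊆ r.domain)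
    (hdisj : ∀ j j', j ≠ j' → volume (D j ∩ D j') = 0)
    (hcov : volume (r.domain \ ⋃ j, D j) = 0)
    (hloc : ∀ j, ∃ (T : RTerm b) (hT : T.Admissible), FoldsTo (r.restrict (D j) (hD j) (hDr j)) T hT) :
    ∃ (T : RTerm b) (hT : T.Admissible), FoldsTo r T hT := by
  induction N generalizing r with
  | zero =>
    refine ⟨RTerm.empty b, RTerm.empty_admissible b, foldsTo_empty_of_null ?_⟩
    simpa using hcov
  | succ N ih =>
    -- the union of the first `N` pieces and the last piece
    set U : Set (Fin (b + 1) → ℝ) := ⋃ j : Fin N, D (Fin.castSucc j) with hU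
    have hUs : IsSemialgebraic ℚ U := isSemialgebraic_iUnion_fin fun j => hD _
    have hUr : U ⊆ r.domain := iUnion_subset fun j => hDr _
    set L := D (Fin.last N) with hL
    have hLs : IsSemialgebraic ℚ L := hD _
    have hLr : L ⊆ r.domain := hDr _
    have hWs : IsSemialgebraic ℚ (U ∪ L) := hUs.union hLs
    have hWr : U ∪ L ⊆ r.domain := union_subset hUr hLr
    -- fold the first `N` pieces (induction hypothesis applied to `r|U`)
    set rU := r.restrict U hUs hUr with hrU
    obtain ⟨T₁, hT₁, hf₁⟩ := ih (r := rU) (fun j => D (Fin.castSucc j)) (fun j => hD _)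
      (fun j => subset_iUnion (fun j : Fin N => D (Fin.castSucc j)) j)
      (fun j j' hjj' => hdisj _ _ fun h => hjj' (Fin.castSucc_injective _ h))
      (by simp [rU, hU]) (fun j => hloc (Fin.castSucc j))
    obtain ⟨T₂, hT₂, hf₂⟩ := hloc (Fin.last N)
    -- glue `r|U` and `r|L` into `r|(U ∪ L)`, then remove the null complement
    have hnull : volume (rU.domain ∩ (r.restrict L hLs hLr).domain) = 0 := by
      show volume (U ∩ L) = 0
      rw [hU, iUnion_inter]
      exact measure_iUnion_null fun j => hdisj _ _ (Fin.castSucc_lt_last j).ne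
    have hW : FoldsTo (r.restrict (U ∪ L) hWs hWr) (T₁.glue T₂) (hT₁.glue hT₂) :=
      FoldsTo.glue (r₁ := rU) (r₂ := r.restrict L hLs hLr) rfl hnull (fun _ _ => rfl)
        (fun _ _ => rfl) hf₁ hf₂
    have hsub : r.domain \ (U ∪ L) ⊆ r.domain \ ⋃ j, D j := by
      intro z hz
      refine ⟨hz.1, fun hz' => hz.2 ?_⟩
      rwa [iUnion_fin_succ] at hz'
    exact ⟨_, _, FoldsTo.of_restrict hWs hWr (measure_mono_null hsub hcov) hW⟩

/-! ### §9. THE ONE-BAND TEMPLATE (Newton–Leibniz over one cell)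

After the cylindrical decomposition the provers of items 30571 / 30573 meet representations whose
domain is ONE open band `{(x,t) | x ∈ σ, α x < t < β x}` over one cell `σ`; whenever a fibrewise
primitive `F` of the integrand is at hand (`ℚ`-semialgebraic on the closed band, continuous on the
closed fibres, `∂ₜF = f` on the open ones) the band FOLDS to the pure base term `[σ, F(·,β) − F(·,α)]`
— the relation is ONE Newton–Leibniz move (plus the free passage open band ↔ closed band, which is
an equality of zero-extended integrands), the fibre identity is the fundamental theorem of calculus
on a.e. fibre, and the integrability of the boundary term on `σ` is DERIVED (Fubini). -/

/-- Fibre integrals of a representation are integrable on the base (Fubini). [folklore] -/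
theorem integrable_fibre_integral (r : KZ.IntegralRep (b + 1)) :
    Integrable fun x : Fin b → ℝ =>
      ∫ t in {t : ℝ | (Fin.snoc x t : Fin (b + 1) → ℝ) ∈ r.domain}, r.integrand (Fin.snoc x t) := by
  have hG : Integrable (r.domain.indicator r.integrand) :=
    (integrable_indicator_iff (KZ.IntegralRep.measurableSet_domain_holds r)).2 r.integrableOn
  have h1 := (integrable_snoc_prod hG).integral_prod_right
  refine (h1.congr (ae_of_all _ fun x => ?_)).mono_measure le_rfl
  exact integral_indicator_snoc r x

namespace RTerm

/-- The pure base term `[σ, h₀]` (no monomials). -/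
def base (σ : Set (Fin b → ℝ)) (h₀ : (Fin b → ℝ) → ℝ) : RTerm b :=
  ⟨σ, h₀, 0, Fin.elim0, Fin.elim0, Fin.elim0, Fin.elim0⟩

/-- `base_admissible`: auxiliary theorem of the `RegFoldingDegOne` (stmt-30571) development — see the module docstring; statement and proof verbatim from the lens-3 g9 landing file. -/
theorem base_admissible {σ : Set (Fin b → ℝ)} {h₀ : (Fin b → ℝ) → ℝ} (hσ : IsSemialgebraic ℚ σ)
    (hh₀ : IsSemialgebraicFunOn ℚ σ h₀) (hh₀i : IntegrableOn h₀ σ) : (base σ h₀).Admissible where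
  isSemialgebraic_domain := hσ
  isSemialgebraicFunOn_h₀ := hh₀
  integrableOn_h₀ := hh₀i
  isSemialgebraicFunOn_h := fun i => i.elim0
  isSemialgebraicFunOn_κ := fun i => i.elim0
  e_mem := fun i => i.elim0
  neg_one_lt_κ := fun i => i.elim0
  isSemialgebraicFunOn_monomial := fun i => i.elim0
  integrableOn_monomial := fun i => i.elim0
  integrableOn_monomial_base := fun i => i.elim0

/-- `base_domain`: auxiliary theorem of the `RegFoldingDegOne` (stmt-30571) development — see the module docstring; statement and proof verbatim from the lens-3 g9 landing file. -/
@[simp] theorem base_domain (σ : Set (Fin b → ℝ)) (h₀ : (Fin b → ℝ) → ℝ) :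
    (base σ h₀).domain = σ := rfl

/-- `integrand_base`: auxiliary theorem of the `RegFoldingDegOne` (stmt-30571) development — see the module docstring; statement and proof verbatim from the lens-3 g9 landing file. -/
theorem integrand_base (σ : Set (Fin b → ℝ)) (h₀ : (Fin b → ℝ) → ℝ) :
    (base σ h₀).integrand = h₀ := by
  funext x
  simp [integrand, base]

/-- `unfold_base`: auxiliary theorem of the `RegFoldingDegOne` (stmt-30571) development — see the module docstring; statement and proof verbatim from the lens-3 g9 landing file. -/
theorem unfold_base {σ : Set (Fin b → ℝ)} {h₀ : (Fin b → ℝ) → ℝ} (hT : (base σ h₀).Admissible) :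
    unfold (base σ h₀) hT = KZ.of (baseRep (base σ h₀) hT) := by
  simp [unfold, base]

end RTerm

/-- **The one-band template.** `r` lives on the open band over `σ` between `α ≤ β`; `F` is a
fibrewise primitive of `r.integrand`, `ℚ`-semialgebraic on the closed band; `h₀ = F(·,β) − F(·,α)`
is `ℚ`-semialgebraic on `σ`. Then `r` folds to the base term `[σ, h₀]` (its integrability on `σ`
is part of the conclusion). [KZ 2001, §1.2 rule (3); folklore] -/
theorem foldsTo_band_of_primitive (r : KZ.IntegralRep (b + 1)) {σ : Set (Fin b → ℝ)}
    (hσ : IsSemialgebraic ℚ σ) {α β : (Fin b → ℝ) → ℝ} (hα : IsSemialgebraicFunOn ℚ σ α)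
    (hβ : IsSemialgebraicFunOn ℚ σ β) (hαβ : ∀ x ∈ σ, α x ≤ β x)
    (hdom : r.domain = {z : Fin (b + 1) → ℝ | (Fin.init z : Fin b → ℝ) ∈ σ ∧
      α (Fin.init z) < z (Fin.last b) ∧ z (Fin.last b) < β (Fin.init z)})
    {F : (Fin (b + 1) → ℝ) → ℝ} (hF : IsSemialgebraicFunOn ℚ (KZlog.band σ α β) F)
    (hFc : ∀ x ∈ σ, ContinuousOn (fun t : ℝ => F (Fin.snoc x t)) (Icc (α x) (β x)))
    (hFd : ∀ x ∈ σ, ∀ t ∈ Ioo (α x) (β x),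
      HasDerivAt (fun s : ℝ => F (Fin.snoc x s)) (r.integrand (Fin.snoc x t)) t)
    {h₀ : (Fin b → ℝ) → ℝ} (hh₀ : IsSemialgebraicFunOn ℚ σ h₀)
    (hh₀F : ∀ x ∈ σ, h₀ x = F (Fin.snoc x (β x)) - F (Fin.snoc x (α x))) :
    ∃ hT : (RTerm.base σ h₀).Admissible, FoldsTo r (RTerm.base σ h₀) hT := by
  have hσm : MeasurableSet σ := hσ.measurableSet_holds
  have hG : Integrable (r.domain.indicator r.integrand) :=
    (integrable_indicator_iff (KZ.IntegralRep.measurableSet_domain_holds r)).2 r.integrableOn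
  -- the fibres of `r`
  have hfib_in : ∀ x ∈ σ, {t : ℝ | (Fin.snoc x t : Fin (b + 1) → ℝ) ∈ r.domain} = Ioo (α x) (β x) := by
    intro x hx
    ext t
    simp [hdom, hx]
  have hfib_out : ∀ x ∉ σ, {t : ℝ | (Fin.snoc x t : Fin (b + 1) → ℝ) ∈ r.domain} = ∅ := by
    intro x hx
    ext t
    simp [hdom, hx]
  -- (i) the fibre identity, a.e. (FTC on every fibre along which `r` is integrable)
  have hfibre : ∀ᵐ x : (Fin b → ℝ), (∫ t in {t : ℝ | (Fin.snoc x t : Fin (b + 1) → ℝ) ∈ r.domain},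
      r.integrand (Fin.snoc x t)) = σ.indicator h₀ x := by
    filter_upwards [ae_integrable_snoc hG] with x hx
    by_cases hxσ : x ∈ σ
    · rw [hfib_in x hxσ, indicator_of_mem hxσ, hh₀F x hxσ]
      have hint : IntegrableOn (fun t : ℝ => r.integrand (Fin.snoc x t)) (Ioo (α x) (β x)) := by
        have hfun : (fun t : ℝ => r.domain.indicator r.integrand (Fin.snoc x t)) =
            (Ioo (α x) (β x)).indicator fun t : ℝ => r.integrand (Fin.snoc x t) := by
          funext t
          rw [← hfib_in x hxσ]
          exact (Set.indicator_comp_right (fun t : ℝ => (Fin.snoc x t : Fin (b + 1) → ℝ))).symm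
        rw [hfun] at hx
        exact (integrable_indicator_iff measurableSet_Ioo).1 hx
      rw [← integral_Ioc_eq_integral_Ioo, ← intervalIntegral.integral_of_le (hαβ x hxσ)]
      exact intervalIntegral.integral_eq_sub_of_hasDerivAt_of_le (hαβ x hxσ) (hFc x hxσ)
        (hFd x hxσ) ((intervalIntegrable_iff_integrableOn_Ioo_of_le (hαβ x hxσ)).2 hint)
    · rw [hfib_out x hxσ, indicator_of_notMem hxσ, Measure.restrict_empty, integral_zero_measure]
  -- (ii) integrability of `h₀` on `σ` (Fubini)
  have hh₀i : IntegrableOn h₀ σ := by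
    rw [← integrable_indicator_iff hσm]
    exact (integrable_fibre_integral r).congr hfibre
  have hT : (RTerm.base σ h₀).Admissible := RTerm.base_admissible hσ hh₀ hh₀i
  refine ⟨hT, ?_, ?_⟩
  · -- (iii) the relation: open band = closed band (equal zero-extensions) + one Newton–Leibniz move
    have hB : IsSemialgebraic ℚ (KZlog.band σ α β) := KZlog.isSemialgebraic_band hα hβ
    have hsub : r.domain ⊆ KZlog.band σ α β := by
      intro z hz
      rw [hdom] at hz
      exact ⟨hz.1, hz.2.1.le, hz.2.2.le⟩
    let rc : KZ.IntegralRep (b + 1) := ⟨KZlog.band σ α β, r.domain.indicator r.integrand, hB,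
      isSemialgebraicFunOn_indicator r.isSemialgebraic_domain hB r.isSemialgebraicFunOn_integrand,
      hG.integrableOn⟩
    have h1 : KZ.of r - KZ.of rc ∈ KZ.relations := by
      refine AECongr.of_sub_of_mem_relations_of_indicator_ae r rc (ae_of_all _ fun z => ?_)
      show r.domain.indicator r.integrand z =
        (KZlog.band σ α β).indicator (r.domain.indicator r.integrand) z
      rw [Set.indicator_indicator, inter_eq_right.2 hsub]
    have h2 : KZ.of rc - KZ.of (RTerm.baseRep (RTerm.base σ h₀) hT) ∈ KZ.newtonLeibnizRel := by
      refine ⟨b, rc, RTerm.baseRep (RTerm.base σ h₀) hT, α, β, F, hF, hα, hβ, hαβ, rfl, hFc, ?_,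
        hh₀F, rfl⟩
      intro x hx t ht
      have hmem : (Fin.snoc x t : Fin (b + 1) → ℝ) ∈ r.domain := by
        rw [← mem_setOf_eq (p := fun t : ℝ => (Fin.snoc x t : Fin (b + 1) → ℝ) ∈ r.domain),
          hfib_in x hx]
        exact ht
      show HasDerivAt (fun s : ℝ => F (Fin.snoc x s)) (r.domain.indicator r.integrand (Fin.snoc x t)) t
      rw [indicator_of_mem hmem]
      exact hFd x hx t ht
    rw [RTerm.unfold_base,
      show KZ.of r - KZ.of (RTerm.baseRep (RTerm.base σ h₀) hT) =
        (KZ.of r - KZ.of rc) + (KZ.of rc - KZ.of (RTerm.baseRep (RTerm.base σ h₀) hT)) by abel]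
    exact add_mem h1 (KZ.newtonLeibnizRel_subset_relations h2)
  · -- (iv) the fibre identity in `FoldsTo` form
    filter_upwards [hfibre] with x hx
    rw [hx, RTerm.base_domain, RTerm.integrand_base]

/-- **Transport.** A representation with the same class and the same fibre integrals a.e. folds to
the same term (used after a fibrewise change of variables, e.g. the affine chart of a band). -/
theorem FoldsTo.of_rel_of_fibre_ae {r r' : KZ.IntegralRep (b + 1)} {T : RTerm b} {hT : T.Admissible}
    (hrel : KZ.of r - KZ.of r' ∈ KZ.relations)
    (hfib : ∀ᵐ x : (Fin b → ℝ), (∫ t in {t : ℝ | (Fin.snoc x t : Fin (b + 1) → ℝ) ∈ r.domain},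
        r.integrand (Fin.snoc x t)) =
      ∫ t in {t : ℝ | (Fin.snoc x t : Fin (b + 1) → ℝ) ∈ r'.domain}, r'.integrand (Fin.snoc x t))
    (h : FoldsTo r' T hT) : FoldsTo r T hT := by
  refine ⟨?_, ?_⟩
  · have e : KZ.of r - RTerm.unfold T hT = (KZ.of r - KZ.of r') + (KZ.of r' - RTerm.unfold T hT) := by
      abel
    rw [e]
    exact add_mem hrel h.1
  · filter_upwards [hfib, h.2] with x hx hx'
    rw [hx, hx']

/-- **Integrand additivity.** Same domain, integrand split as a sum: the folds glue. -/
theorem FoldsTo.add {r r₁ r₂ : KZ.IntegralRep (b + 1)} {T₁ T₂ : RTerm b} {hT₁ : T₁.Admissible}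
    {hT₂ : T₂.Admissible} (hd₁ : r₁.domain = r.domain) (hd₂ : r₂.domain = r.domain)
    (hsum : EqOn r.integrand (r₁.integrand + r₂.integrand) r.domain) (h₁ : FoldsTo r₁ T₁ hT₁)
    (h₂ : FoldsTo r₂ T₂ hT₂) : FoldsTo r (T₁.glue T₂) (hT₁.glue hT₂) := by
  refine ⟨?_, ?_⟩
  · have hadd : KZ.of r - KZ.of r₁ - KZ.of r₂ ∈ KZ.integrandAddRel :=
      ⟨_, r, r₁, r₂, hd₁, hd₂, hsum, rfl⟩
    have hu := RTerm.unfold_glue_sub_mem T₁ T₂ hT₁ hT₂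
    have e : KZ.of r - RTerm.unfold (T₁.glue T₂) (hT₁.glue hT₂) =
        (KZ.of r - KZ.of r₁ - KZ.of r₂) + (KZ.of r₁ - RTerm.unfold T₁ hT₁) +
          (KZ.of r₂ - RTerm.unfold T₂ hT₂) -
          (RTerm.unfold (T₁.glue T₂) (hT₁.glue hT₂) - RTerm.unfold T₁ hT₁ - RTerm.unfold T₂ hT₂) := by
      abel
    rw [e]
    exact sub_mem (add_mem (add_mem (KZ.integrandAddRel_subset_relations hadd) h₁.1) h₂.1) hu
  · have hi₁ := ae_integrable_snoc ((integrable_indicator_iff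
      (KZ.IntegralRep.measurableSet_domain_holds r₁)).2 r₁.integrableOn)
    have hi₂ := ae_integrable_snoc ((integrable_indicator_iff
      (KZ.IntegralRep.measurableSet_domain_holds r₂)).2 r₂.integrableOn)
    have hpt : ∀ z : Fin (b + 1) → ℝ, r.domain.indicator r.integrand z =
        r₁.domain.indicator r₁.integrand z + r₂.domain.indicator r₂.integrand z := by
      intro z
      by_cases hz : z ∈ r.domain
      · have hz₁ : z ∈ r₁.domain := by rw [hd₁]; exact hz
        have hz₂ : z ∈ r₂.domain := by rw [hd₂]; exact hz
        rw [indicator_of_mem hz, indicator_of_mem hz₁, indicator_of_mem hz₂, hsum hz, Pi.add_apply]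
      · have hz₁ : z ∉ r₁.domain := by rw [hd₁]; exact hz
        have hz₂ : z ∉ r₂.domain := by rw [hd₂]; exact hz
        rw [indicator_of_notMem hz, indicator_of_notMem hz₁, indicator_of_notMem hz₂, add_zero]
    filter_upwards [h₁.2, h₂.2, hi₁, hi₂] with x hx₁ hx₂ i1 i2
    rw [RTerm.indicator_integrand_glue, ← hx₁, ← hx₂, ← integral_indicator_snoc r,
      ← integral_indicator_snoc r₁, ← integral_indicator_snoc r₂, ← integral_add i1 i2]
    exact integral_congr_ae (ae_of_all _ fun t => hpt _)

namespace RTerm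

/-- The single-monomial term `[σ; 0; (h, κ, M, e)]`. -/
def single (σ : Set (Fin b → ℝ)) (h κ : (Fin b → ℝ) → ℝ) (M e : ℕ) : RTerm b :=
  ⟨σ, 0, 1, fun _ => h, fun _ => κ, fun _ => M, fun _ => e⟩

/-- `single_domain`: auxiliary theorem of the `RegFoldingDegOne` (stmt-30571) development — see the module docstring; statement and proof verbatim from the lens-3 g9 landing file. -/
@[simp] theorem single_domain (σ : Set (Fin b → ℝ)) (h κ : (Fin b → ℝ) → ℝ) (M e : ℕ) :
    (single σ h κ M e).domain = σ := rfl

/-- `integrand_single`: auxiliary theorem of the `RegFoldingDegOne` (stmt-30571) development — see the module docstring; statement and proof verbatim from the lens-3 g9 landing file. -/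
theorem integrand_single (σ : Set (Fin b → ℝ)) (h κ : (Fin b → ℝ) → ℝ) (M e : ℕ) :
    (single σ h κ M e).integrand = fun x => h x * ell M e (κ x) := by
  funext x
  simp [integrand, single]

/-- `monomialFun_single`: auxiliary theorem of the `RegFoldingDegOne` (stmt-30571) development — see the module docstring; statement and proof verbatim from the lens-3 g9 landing file. -/
theorem monomialFun_single (σ : Set (Fin b → ℝ)) (h κ : (Fin b → ℝ) → ℝ) (M e : ℕ)
    (i : Fin (single σ h κ M e).k) :
    (single σ h κ M e).monomialFun i =
      fun z => h (Fin.init z) * kernel M e (κ (Fin.init z)) (z (Fin.last b)) := by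
  funext z
  simp [monomialFun, single]

/-- `[σ, 0]` is a relation (integrand additivity `0 = 0 + 0`). [folklore] -/
theorem of_zero_mem_relations (g : KZ.IntegralRep b) (hg : g.integrand = 0) :
    KZ.of g ∈ KZ.relations := by
  have h : KZ.of g - KZ.of g - KZ.of g ∈ KZ.integrandAddRel :=
    ⟨_, g, g, g, rfl, rfl, fun x _ => by simp [hg], rfl⟩
  have e : KZ.of g = -(KZ.of g - KZ.of g - KZ.of g) := by abel
  rw [e]
  exact neg_mem (KZ.integrandAddRel_subset_relations h)

end RTerm

end Folds

end RegularisedLogLayer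

end Summit.KontsevichZagierPeriods.RootDecompRelativeModAbsolute.Rung30571

end
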